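import Literature.AlgebraicTopology.SingularHomology.LocalHomology
import Literature.AlgebraicTopology.SingularHomology.RelativeCapProduct
import Literature.AlgebraicTopology.SingularHomology.ExcisionMayerVietoris
import HarnessLib

/-!
# The excision theorem for singular homology: discharge of the named facts
`Literature.AlgebraicTopology.SingularHomology.relativeSingularHomology.isIso_map_of_interior_union_interior` and
`Literature.AlgebraicTopology.SingularHomology.relativeSingularHomology.isIso_map_of_closure_subset_interior`

`Literature.AlgebraicTopology.SingularHomology.ExcisionMayerVietoris` states the excision theorem
for the relative singular homology `Literature.relativeSingularHomology R M X A n` (Mathlib's model: the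
homology of the cokernel of `C(↥A) ⟶ C(X)` in Mathlib's singular chain complex) as two **named
facts** (D-0014), A. Hatcher, *Algebraic Topology*, CUP 2002, Thm. 2.20 (p. 119):

* `isIso_map_of_interior_union_interior R M X`: for subspaces `A, B ⊆ X` whose interiors cover
  `X`, the inclusion `(B, A ∩ B) ↪ (X, A)` induces isomorphisms `Hₙ(B, A ∩ B; M) ≅ Hₙ(X, A; M)`;
* `isIso_map_of_closure_subset_interior R M X`: for `closure U ⊆ interior A`, the inclusion
  `(X ∖ U, A ∖ U) ↪ (X, A)` induces isomorphisms `Hₙ(X ∖ U, A ∖ U; M) ≅ Hₙ(X, A; M)`.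

Here both are **proved**, for every space `X`, commutative ring `R` and `R`-module `M`
(`…_holds`). The proof is Hatcher's (pp. 119–124): Prop. 2.21 (the inclusion
`C(A) + C(B) ↪ C(X)` of `{A, B}`-small chains is a quasi-isomorphism when the interiors of `A` and
`B` cover `X`), then `C(B)/C(A ∩ B) = C(B)/(C(A) ∩ C(B)) ≅ (C(A) + C(B))/C(A) ⟶ C(X)/C(A)` is a
quasi-isomorphism by the five lemma; the second form is the first one with `B = X ∖ U`.

All the chain-level work is already in the tree, in the *concrete* model
`Literature.AlgebraicTopology.SingularHomology.csingularChainComplex` of `…SingularChainsConcrete`: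
`Literature.AlgebraicTopology.SingularHomology.LocalHomology` proves Prop. 2.21 for families of
**open** sets (`Literature.AlgebraicTopology.SingularHomology.isIso_homologyMap_incl_smallSub`: iterated barycentric subdivision `Sʲ`, the
chain homotopies `Dⱼ`, and "every chain becomes small", `Literature.AlgebraicTopology.SingularHomology.exists_sdX_pow_mem_smallChains`) and
the algebraic excision step (`Literature.AlgebraicTopology.SingularHomology.Subcomplex.isIso_homologyMap_quotMap_of_sup` of
`…ChainSubcomplex`), and `Literature.AlgebraicTopology.SingularHomology.RelativeCapProduct`
identifies Mathlib's model of the chains of a pair with the concrete quotient complex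
(`Literature.AlgebraicTopology.SingularHomology.relativeSingularChainComplex.quotientIso`, `Literature.AlgebraicTopology.SingularHomology.relativeSingularHomology.concreteIso`).
What we add:

* `Literature.AlgebraicTopology.SingularHomology.isIso_homologyMap_incl_smallSub_of_subdivision`: Prop. 2.21 for an **arbitrary** family
  `U` with `Uᵢ ⊆ Y`, under the hypothesis that every chain in `Y` becomes `𝒰`-small after iterated
  subdivision (the proof of `Literature.AlgebraicTopology.SingularHomology.isIso_homologyMap_incl_smallSub`, which uses openness only
  through that property, verbatim);
* `Literature.AlgebraicTopology.SingularHomology.exists_sdX_pow_mem_smallChains_of_interior`, `Literature.AlgebraicTopology.SingularHomology.isIso_homologyMap_ι_sup_of_interior`,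
  `Literature.AlgebraicTopology.SingularHomology.isIso_homologyMap_quotMap_excision_of_interior`: the case `𝒰 = {A, B}` with
  `interior A ∪ interior B = X` (small for `{interior A, interior B}` implies small for `{A, B}`),
  i.e. Prop. 2.21 and Thm. 2.20 exactly under Hatcher's hypothesis, in the concrete model;
* `Literature.AlgebraicTopology.SingularHomology.relativeSingularChainComplex.map_comp_quotientIso_hom`,
  `Literature.AlgebraicTopology.SingularHomology.relativeSingularHomology.map_eq_concrete`: naturality of the comparison isomorphism of
  `…RelativeCapProduct` under maps of pairs;
* the discharges `Literature.AlgebraicTopology.SingularHomology.relativeSingularHomology.isIso_map_of_interior_union_interior_holds` and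
  `Literature.AlgebraicTopology.SingularHomology.relativeSingularHomology.isIso_map_of_closure_subset_interior_holds`.

Everything is proved; no new definitions; nothing is asserted.

## References

* A. Hatcher, *Algebraic Topology*, CUP 2002, §2.1, Prop. 2.21 (p. 119) and Thm. 2.20
  (excision, p. 119; proofs pp. 119–124) [HatcherAT2002].

## Design notes

* As in `…SingularChainsConcrete`/`…LocalHomology`, `backward.isDefEq.respectTransparency` is
  turned off for this file (chains of the concrete complex are `Finsupp`s up to unfolding).
* No declaration in this file uses `sorry`.
-/

noncomputable section

-- as in `SingularChainsConcrete` / `LocalHomology`: chains of the concrete complex are `Finsupp`s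
-- up to unfolding
set_option backward.isDefEq.respectTransparency false

open CategoryTheory Limits Set

universe u v

namespace Literature.AlgebraicTopology.SingularHomology

variable (R : Type v) [CommRing R] (M : Type v) [AddCommGroup M] [Module R M]

/-! ### Prop. 2.21 for covers whose interiors cover -/

section SmallChains

variable {X : Type u} [TopologicalSpace X]

/-- Small chains are monotone in the family of subsets: if `Uᵢ ⊆ U'ᵢ` for all `i` then
`∑ᵢ Cₙ(Uᵢ) ≤ ∑ᵢ Cₙ(U'ᵢ)`. [folklore] -/
lemma smallChains_mono {ι : Type*} {U U' : ι → Set X} (h : ∀ i, U i ⊆ U' i) (n : ℕ) :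
    smallChains R M X U n ≤ smallChains R M X U' n :=
  iSup_mono fun i => chainsIn_mono R M (h i) n

/-- **Hatcher Prop. 2.21 (small chains compute homology), general form.** Let `U` be any family
of subsets of `X` and `Y` a subset with `Uᵢ ⊆ Y` such that every chain with image in `Y` becomes
`𝒰`-small after iterated barycentric subdivision (`Sʲ c ∈ ∑ᵢ C(Uᵢ)` for some `j`; this holds when
`Y ⊆ ⋃ᵢ interior Uᵢ`, Hatcher 2002, proof of Prop. 2.21, step (4)). Then the inclusion
`C^𝒰 = ∑ᵢ C(Uᵢ) ↪ C(Y)` induces isomorphisms on all homology groups. The proof is that of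
`Literature.AlgebraicTopology.SingularHomology.isIso_homologyMap_incl_smallSub` (`…LocalHomology`, the case of open `Uᵢ`), which uses
openness only through this subdivision property: `Sʲ` and `Dⱼ = ∑_{i<j} T Sⁱ` with
`∂Dⱼ + Dⱼ∂ = 𝟙 - Sʲ` preserve each `C(Uᵢ)`. [cite: HatcherAT2002, Prop. 2.21] -/
theorem isIso_homologyMap_incl_smallSub_of_subdivision {ι : Type*} (U : ι → Set X) {Y : Set X}
    (hUY : ∀ i, U i ⊆ Y)
    (hsmall : ∀ {n : ℕ} (c : CChain M X n), c ∈ chainsIn R M X Y n →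
      ∃ j : ℕ, ((sdX R M n) ^ j) c ∈ smallChains R M X U n)
    (k : ℕ) :
    IsIso (HomologicalComplex.homologyMap
      (Subcomplex.incl (smallSub_le_chainsInSub R M hUY :
        smallSub R M X U ≤ chainsInSub R M X Y)) k) := by
  -- `∂ (Dⱼ z) = z - Sʲ z` for a cycle `z` (in every degree)
  have hD : ∀ (k j : ℕ) (zc : CChain M X k), (∀ k', k = k' + 1 → ∀ (h : k = k' + 1),
      csingularChainComplex.bd R k' (h ▸ zc) = 0) →
      csingularChainComplex.bd R k (sdhSum R M j k zc) + ((sdX R M k) ^ j) zc = zc := by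
    intro k j zc hzc
    cases k with
    | zero => rw [bd_sdhSum_zero, sdX_pow_zero_apply, zero_add]
    | succ k =>
      have h := bd_sdhSum_add_sdhSum_bd (R := R) (M := M) j zc
      rw [hzc k rfl rfl, map_zero, add_zero] at h
      rw [h, sub_add_cancel]
  rw [ConcreteCategory.isIso_iff_bijective]
  constructor
  · -- injectivity: a small cycle bounding in `C(Y)` bounds in `C^𝒰`
    refine (homologyMap_injective_iff _).mpr fun z hz hb => ?_
    rw [exists_d_prev_eq_iff (ChainComplex.prev ℕ k)] at hb ⊢
    obtain ⟨w, hw⟩ := hb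
    set zc : CChain M X k := z.1 with hzc
    set wc : CChain M X (k + 1) := w.1 with hwc
    have hw' : csingularChainComplex.bd R k wc = zc := by
      rw [hwc, hzc, ← toComplex_d_val, hw]
      rfl
    have hcyc : ∀ k', k = k' + 1 → ∀ (h : k = k' + 1), csingularChainComplex.bd R k' (h ▸ zc) = 0 := by
      rintro k' rfl h
      rw [d_next_eq_zero_iff (ChainComplex.next_nat_succ k')] at hz
      rw [hzc, ← toComplex_d_val, hz]
      rfl
    obtain ⟨j, hj⟩ := hsmall wc w.2
    refine ⟨⟨((sdX R M (k + 1)) ^ j) wc + sdhSum R M j k zc,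
      Submodule.add_mem _ hj (sdhSum_mem_smallChains R M U j z.2)⟩, Subtype.ext ?_⟩
    rw [toComplex_d_val]
    change csingularChainComplex.bd R k (((sdX R M (k + 1)) ^ j) wc + sdhSum R M j k zc) = zc
    rw [map_add, ← sdX_pow_bd, hw', add_comm, hD k j zc hcyc]
  · -- surjectivity: every cycle of `C(Y)` is homologous to a small cycle
    refine (homologyMap_surjective_iff _).mpr fun z hz => ?_
    set zc : CChain M X k := z.1 with hzc
    have hcyc : ∀ k', k = k' + 1 → ∀ (h : k = k' + 1), csingularChainComplex.bd R k' (h ▸ zc) = 0 := by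
      rintro k' rfl h
      rw [d_next_eq_zero_iff (ChainComplex.next_nat_succ k')] at hz
      rw [hzc, ← toComplex_d_val, hz]
      rfl
    obtain ⟨j, hj⟩ := hsmall zc z.2
    refine ⟨⟨((sdX R M k) ^ j) zc, hj⟩, ?_, ?_⟩
    · -- `Sʲ z` is a cycle
      cases k with
      | zero => exact toComplex_d_zero_next R M _ _
      | succ k =>
        rw [d_next_eq_zero_iff (ChainComplex.next_nat_succ k)]
        apply Subtype.ext
        rw [toComplex_d_val]
        change csingularChainComplex.bd R k (((sdX R M (k + 1)) ^ j) zc) = 0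
        rw [← sdX_pow_bd, hcyc k rfl rfl, map_zero]
    · rw [exists_d_prev_eq_iff (ChainComplex.prev ℕ k)]
      refine ⟨⟨sdhSum R M j k zc, sdhSum_mem_chainsIn j z.2⟩, Subtype.ext ?_⟩
      rw [toComplex_d_val]
      change csingularChainComplex.bd R k (sdhSum R M j k zc) = zc - ((sdX R M k) ^ j) zc
      rw [eq_sub_iff_add_eq, hD k j zc hcyc]

/-- The two-set family `{A, B}` indexed by `Bool` (`true ↦ A`, `false ↦ B`), as in
`Literature.AlgebraicTopology.SingularHomology.smallSub_bool`. [folklore] -/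
lemma iUnion_cond_eq_union {α : Type*} (A B : Set α) : (⋃ b : Bool, cond b A B) = A ∪ B := by
  refine Set.Subset.antisymm (Set.iUnion_subset fun b => ?_) ?_
  · cases b
    · exact Set.subset_union_right
    · exact Set.subset_union_left
  · rintro x (hx | hx)
    · exact Set.mem_iUnion.mpr ⟨true, hx⟩
    · exact Set.mem_iUnion.mpr ⟨false, hx⟩

/-- **Every chain becomes `{A, B}`-small after iterated subdivision when the interiors of `A` and
`B` cover `X`** (Hatcher 2002, proof of Prop. 2.21, step (4), for the cover `𝒰 = {A, B}`): a chain
small for the open family `{interior A, interior B}` is small for `{A, B}`. [cite: HatcherAT2002, Prop. 2.21] -/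
theorem exists_sdX_pow_mem_smallChains_of_interior (A B : Set X)
    (hAB : interior A ∪ interior B = Set.univ) {n : ℕ} (c : CChain M X n) :
    ∃ j : ℕ, ((sdX R M n) ^ j) c ∈ smallChains R M X (fun b : Bool => cond b A B) n := by
  have hU : ∀ b : Bool, IsOpen (cond b (interior A) (interior B)) := fun b => by
    cases b
    · exact isOpen_interior
    · exact isOpen_interior
  have hcov : (⋃ b : Bool, cond b (interior A) (interior B)) = Set.univ := by
    rw [iUnion_cond_eq_union, hAB]
  have hc : c ∈ chainsIn R M X (⋃ b : Bool, cond b (interior A) (interior B)) n := by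
    rw [hcov, chainsIn_univ]
    exact Submodule.mem_top
  obtain ⟨j, hj⟩ := exists_sdX_pow_mem_smallChains R M _ hU hc
  refine ⟨j, smallChains_mono R M (fun b => ?_) n hj⟩
  cases b
  · exact interior_subset
  · exact interior_subset

/-- **Prop. 2.21 for two subspaces whose interiors cover `X`**: `C(A) + C(B) ↪ C(X)` induces
isomorphisms on all homology groups when `interior A ∪ interior B = X` (Hatcher 2002, Prop. 2.21
with `𝒰 = {A, B}`; the input of excision and of the Mayer–Vietoris sequence, pp. 119, 149).
[cite: HatcherAT2002, Prop. 2.21] -/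
theorem isIso_homologyMap_ι_sup_of_interior (A B : Set X)
    (hAB : interior A ∪ interior B = Set.univ) (k : ℕ) :
    IsIso (HomologicalComplex.homologyMap (chainsInSub R M X A ⊔ chainsInSub R M X B).ι k) := by
  have hUY : ∀ b : Bool, cond b A B ⊆ (Set.univ : Set X) := fun _ => Set.subset_univ _
  have h1 := isIso_homologyMap_incl_smallSub_of_subdivision R M (fun b : Bool => cond b A B) hUY
    (fun c _ => exists_sdX_pow_mem_smallChains_of_interior R M A B hAB c) k
  have h2 : IsIso (HomologicalComplex.homologyMap
      (Subcomplex.incl (chainsInSub_univ R M (X := X)).le) k) :=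
    haveI := Subcomplex.isIso_incl_of_eq (chainsInSub_univ R M (X := X))
    inferInstance
  haveI h3 := Subcomplex.isIso_incl_of_eq (smallSub_bool R M A B (X := X)).symm
  rw [← Subcomplex.incl_ι (smallSub_bool R M A B (X := X)).symm.le,
    ← Subcomplex.incl_ι (smallSub_le_chainsInSub R M (U := fun b : Bool => cond b A B) hUY),
    ← Subcomplex.incl_ι (chainsInSub_univ R M (X := X)).le,
    HomologicalComplex.homologyMap_comp, HomologicalComplex.homologyMap_comp,
    HomologicalComplex.homologyMap_comp]
  haveI := h1
  haveI := h2
  infer_instance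

/-- **Excision, concrete form, under Hatcher's hypothesis** (Thm. 2.20 via Prop. 2.21): for
subspaces `A`, `B` with `interior A ∪ interior B = X`, the map of quotient complexes
`C(B)/C(A ∩ B) ⟶ C(X)/C(A)` (with `C(A ∩ B)` realised as the chains of `C(B)` lying in `C(A)`)
induces isomorphisms on homology. (`Literature.AlgebraicTopology.SingularHomology.isIso_homologyMap_quotMap_excision` of `…LocalHomology`
is the case of open `A`, `B`.) [cite: HatcherAT2002, Thm. 2.20] -/
theorem isIso_homologyMap_quotMap_excision_of_interior {A B : Set X}
    (hAB : interior A ∪ interior B = Set.univ) (k : ℕ) :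
    IsIso (HomologicalComplex.homologyMap (Subcomplex.quotMap (chainsInSub R M X B).ι
      ((chainsInSub R M X A).comap (chainsInSub R M X B).ι) (chainsInSub R M X A) le_rfl) k) := by
  refine Subcomplex.isIso_homologyMap_quotMap_of_sup _ _ k ?_ fun j _ => ?_
  · exact isIso_homologyMap_ι_sup_of_interior R M A B hAB k
  · haveI := isIso_homologyMap_ι_sup_of_interior R M A B hAB j
    infer_instance

end SmallChains

/-! ### Naturality of the comparison of the two models of the chains of a pair -/

section Naturality

variable {X Y : Type u} [TopologicalSpace X] [TopologicalSpace Y]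

/-- A map of pairs `f : (X, A) → (Y, B)` sends concrete chains in `A` to chains in `B`:
`C(A) ≤ f♯⁻¹ C(B)` (Hatcher 2002, §2.1, maps of pairs). [folklore] -/
lemma chainsInSub_le_comap_map {A : Set X} {B : Set Y} (f : C(X, Y)) (h : Set.MapsTo f A B) :
    chainsInSub R M X A ≤ (chainsInSub R M Y B).comap (csingularChainComplex.map R M f) := by
  intro n c hc
  rw [Subcomplex.mem_comap, csingularChainComplex.map_f_apply, mem_chainsInSub_iff]
  exact mapDomain_mem_chainsIn R M f h hc

namespace relativeSingularChainComplex

/-- **Naturality of `quotientIso`** (the comparison `C(X, A) ≅ C(X)/C(A)` of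
`…RelativeCapProduct`) under a map of pairs `f : (X, A) → (Y, B)`: Mathlib's `cokernel.map`
corresponds to the concrete `Subcomplex.quotMap f♯` (Hatcher 2002, §2.1, naturality).
[folklore] -/
@[reassoc]
lemma map_comp_quotientIso_hom {A : Set X} {B : Set Y} (f : C(X, Y)) (h : Set.MapsTo f A B) :
    map R M f h ≫ (quotientIso R M Y B).hom =
      (quotientIso R M X A).hom ≫ Subcomplex.quotMap (csingularChainComplex.map R M f)
        (chainsInSub R M X A) (chainsInSub R M Y B) (chainsInSub_le_comap_map R M f h) := by
  haveI := epi_π R M (X := X) A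
  have e : singularChainComplex.map R M f ≫ (csingularChainComplex.compIso R M Y).inv =
      (csingularChainComplex.compIso R M X).inv ≫ csingularChainComplex.map R M f := by
    rw [Iso.comp_inv_eq, Category.assoc, csingularChainComplex.map_comp_compIso_hom,
      Iso.inv_hom_id_assoc]
  rw [← cancel_epi (π R M X A), π_comp_map_assoc]
  change singularChainComplex.map R M f ≫ π R M Y B ≫ toQuotient R M Y B =
    π R M X A ≫ toQuotient R M X A ≫ _
  rw [π_comp_toQuotient, π_comp_toQuotient_assoc, Subcomplex.π_quotMap, ← Category.assoc, e,
    Category.assoc]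

end relativeSingularChainComplex

namespace relativeSingularHomology

/-- **The induced map of a map of pairs in the two models**: under `concreteIso`,
`f_* : Hₙ(X, A; M) → Hₙ(Y, B; M)` is `Hₙ` of the concrete `Subcomplex.quotMap f♯`
(Hatcher 2002, §2.1). [folklore] -/
lemma map_eq_concrete {A : Set X} {B : Set Y} (f : C(X, Y)) (h : Set.MapsTo f A B) (n : ℕ) :
    map R M f h n = (concreteIso R M X A n).hom ≫
      HomologicalComplex.homologyMap (Subcomplex.quotMap (csingularChainComplex.map R M f)
        (chainsInSub R M X A) (chainsInSub R M Y B) (chainsInSub_le_comap_map R M f h)) n ≫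
      (concreteIso R M Y B n).inv := by
  rw [map, concreteIso_hom, concreteIso_inv]
  change _ = HomologicalComplex.homologyMap (relativeSingularChainComplex.quotientIso R M X A).hom n ≫
    _ ≫ HomologicalComplex.homologyMap (relativeSingularChainComplex.quotientIso R M Y B).inv n
  rw [← HomologicalComplex.homologyMap_comp, ← HomologicalComplex.homologyMap_comp,
    ← relativeSingularChainComplex.map_comp_quotientIso_hom_assoc, Iso.hom_inv_id,
    Category.comp_id]

end relativeSingularHomology

end Naturality

/-! ### The excision theorem (Hatcher Thm. 2.20), both forms, for Mathlib's model -/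

section Excision

variable {X : Type u} [TopologicalSpace X]

/-- **Excision in the concrete model, for the subspace `↥B`**: for `interior A ∪ interior B = X`
the map of pairs `(↥B, B ↓∩ A) → (X, A)` induces isomorphisms
`Hₙ(C(↥B)/C(B ↓∩ A)) ≅ Hₙ(C(X)/C(A))` (Hatcher 2002, Thm. 2.20); the quotient map factors as
`C(↥B)/C(B ↓∩ A) ≅ C(B)/(C(A) ⊓ C(B)) ⟶ C(X)/C(A)` through `Literature.AlgebraicTopology.SingularHomology.subspaceLift`.
[cite: HatcherAT2002, Thm. 2.20] -/
theorem isIso_homologyMap_quotMap_subsetIncl_of_interior (A B : Set X)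
    (hAB : interior A ∪ interior B = Set.univ) (n : ℕ) :
    IsIso (HomologicalComplex.homologyMap (Subcomplex.quotMap
      (csingularChainComplex.map R M (subsetIncl B))
      (chainsInSub R M (↥B) (Subtype.val ⁻¹' A)) (chainsInSub R M X A)
      (chainsInSub_le_comap_map R M (subsetIncl B) (Set.mapsTo_preimage Subtype.val A))) n) := by
  set T := chainsInSub R M X B with hT
  set S := chainsInSub R M X A with hS
  have hcomap : chainsInSub R M (↥B) (Subtype.val ⁻¹' A) =
      (S.comap T.ι).comap (subspaceLift R M X B) :=
    chainsInSub_preimage_val_eq_comap_lift R M B A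
  haveI h1 : IsIso (Subcomplex.quotMap (subspaceLift R M X B)
      (chainsInSub R M (↥B) (Subtype.val ⁻¹' A)) (S.comap T.ι) hcomap.le) :=
    Subcomplex.isIso_quotMap _ _ _ hcomap
  have h2 := isIso_homologyMap_quotMap_excision_of_interior R M (A := A) (B := B) hAB n
  have hfac : Subcomplex.quotMap (csingularChainComplex.map R M (subsetIncl B))
      (chainsInSub R M (↥B) (Subtype.val ⁻¹' A)) S
      (chainsInSub_le_comap_map R M (subsetIncl B) (Set.mapsTo_preimage Subtype.val A)) =
      Subcomplex.quotMap (subspaceLift R M X B) _ (S.comap T.ι) hcomap.le ≫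
        Subcomplex.quotMap T.ι (S.comap T.ι) S le_rfl := by
    rw [← Subcomplex.quotMap_comp (hfg := (Subcomplex.comap_comp _ _ S) ▸ hcomap.le)]
    exact Subcomplex.quotMap_congr (subspaceLift_ι R M B).symm _ _ _ _
  rw [hfac, HomologicalComplex.homologyMap_comp]
  haveI := h2
  infer_instance

namespace relativeSingularHomology

variable (X) in
/-- **Discharge of the named fact `Literature.AlgebraicTopology.SingularHomology.relativeSingularHomology.isIso_map_of_interior_union_interior`
(excision, Hatcher 2002, Thm. 2.20, second form):** if the interiors of `A` and `B` cover `X`, the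
inclusion `(B, A ∩ B) ↪ (X, A)` induces isomorphisms `Hₙ(B, A ∩ B; M) ≅ Hₙ(X, A; M)` for all `n`,
for Mathlib's model `Literature.AlgebraicTopology.SingularHomology.relativeSingularHomology`. Proof: transport of the concrete statement
`Literature.AlgebraicTopology.SingularHomology.isIso_homologyMap_quotMap_subsetIncl_of_interior` along the comparison isomorphisms
`concreteIso` (`map_eq_concrete`). [cite: HatcherAT2002, Thm. 2.20] -/
theorem isIso_map_of_interior_union_interior_holds :
    isIso_map_of_interior_union_interior R M X := by
  intro A B hAB n
  rw [map_eq_concrete]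
  haveI := isIso_homologyMap_quotMap_subsetIncl_of_interior R M A B hAB n
  infer_instance

variable (X) in
/-- **Discharge of the named fact `Literature.AlgebraicTopology.SingularHomology.relativeSingularHomology.isIso_map_of_closure_subset_interior`
(excision, Hatcher 2002, Thm. 2.20, first form):** if `closure U ⊆ interior A`, the inclusion
`(X ∖ U, A ∖ U) ↪ (X, A)` induces isomorphisms `Hₙ(X ∖ U, A ∖ U; M) ≅ Hₙ(X, A; M)` for all `n`.
As in Hatcher this is the second form for `B = X ∖ U`: `interior (X ∖ U) = X ∖ closure U ⊇
X ∖ interior A`. [cite: HatcherAT2002, Thm. 2.20] -/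
theorem isIso_map_of_closure_subset_interior_holds :
    isIso_map_of_closure_subset_interior R M X := by
  intro A U hUA n
  have hcov : interior A ∪ interior Uᶜ = Set.univ := by
    rw [interior_compl]
    exact Set.eq_univ_of_forall fun x => (em (x ∈ closure U)).elim
      (fun hx => Or.inl (hUA hx)) Or.inr
  exact isIso_map_of_interior_union_interior_holds R M X A Uᶜ hcov n

end relativeSingularHomology

end Excision

end Literature.AlgebraicTopology.SingularHomology
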